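import Summits.Ventures.CertifiedManyBodySolver.Downfold.PressureContinuumRecord
import HarnessLib

/-!
# The FIRST TYPED P-continuum record of a material: Lu (VSET-v3 M101), kernel-evaluated `by_P` items

Venture CertifiedManyBodySolver, cell `pub/hubbard-downfold`, seat hubbard-downfold-mod-2; namespace
`Summit.Ventures.CertifiedManyBodySolver.Downfold.PCont`. `PressureContinuumRecord` defines the
abstract record `Rec π ω` and its `lookup`; this file instantiates it on the P-axis columns OF RECORD
of elemental lutetium (box #70, lead 2026-08-27T10:02:45Z; `router/P-INTERVALS.tsv` v0.23 rows) and
lets the KERNEL evaluate the `by_P` items (`decide`), so the file format's semantics is checked on real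
data, not only stated:

* pressures in units of 0.1 GPa (`π = ℕ`, order only): columns 0.8 / 22 / 88 / 174 GPa ↦
  `8 / 220 / 880 / 1740`;
* words (`LuWord`): the router WORD tokens of record with grammar annotations dropped (`SA` at 22 and
  88 GPa is an annotation of the word `EPH`, ROUTER §3 / router.py `words_grammar`): `EPH` at all four
  columns; gap words: (0.8,22) and (22,88) `none` («undetermined (P-interpolation)» — (b)-margin
  failure / (h) Sm-type → dhcp inside), (88,174) `some EPH` («EPH — interpolated (P.12e)», kernel
  margin `Inflation.lu_88_174_test`); reach: the IDENTITY span `[0, 0.8)` below the first column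
  (the 0.8-GPa record is the ambient cell) carries `EPH`.

PROVED (all by `decide` on the record, plus the general theorems): the items at 0.8 GPa (computed,
EPH), 10 GPa (interval, no word), 100 GPa (interval, EPH), 200 GPa (unrouted), 0.5 GPa (reach, EPH);
`lu_decided_88_174` — the gap (88,174) is `Decided … EPH`; hence `lu_word_on_88_174` — EVERY
pressure of the closed gap [88, 174] GPa carries the word EPH (`Rec.word_eq_on_gap_of_decided`), with
class «screening» at the two ends and «interpolated» strictly inside (`lu_conf_inside_88_174`); and
`lu_no_word_inside_0p8_22` — no word strictly inside the undetermined gap (0.8, 22).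
WHAT THIS IS NOT: a new reading of Lu (the rows are `router/P-INTERVALS.tsv` M101 as of v0.26; if a
grid-cure column lands — lead R-dq: hcp @6/@13, Sm @40, dhcp @50 — this record is superseded by the
refined one, `PressureContinuumRefine.lookup_insertCol_of_not_mem_gap` governing what may change);
not a certified statement about lutetium (the words are SCREENING-GRADE).
-/

namespace Summit.Ventures.CertifiedManyBodySolver.Downfold

namespace PCont

/-- Router word tokens of record for the Lu columns (annotations dropped). [folklore] -/
inductive LuWord
  /-- e–ph conventional branch (R3c decided: `r_man < θ_c3`) -/
  | EPH
  /-- the R3c straddle word «UND:MIXED+EPH» (not taken by any Lu column; listed for refinements) -/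
  | UND_MIXED_EPH
  deriving DecidableEq, Repr

open LuWord

/-- **The Lu (M101) P-continuum record of record** (P-INTERVALS v0.23–v0.26; pressures in 0.1 GPa):
columns {8, 220, 880, 1740} all `EPH`; gap word `some EPH` only for the gap whose left end is 880;
reach word `EPH` on the identity span below 8. [folklore] -/
def luRec : Rec ℕ LuWord where
  pts := {8, 220, 880, 1740}
  cw := fun _ => EPH
  gw := fun P => if P = 880 then some EPH else none
  rw := fun P => if P < 8 then some EPH else none

/-- At 0.8 GPa: a computed column carrying EPH. [folklore] -/
theorem lu_item_0p8 : (luRec.lookup 8).kind = .computed ∧ (luRec.lookup 8).word = some EPH := by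
  decide

/-- At 10 GPa (inside (0.8, 22)): an interval item with NO word («undetermined»). [folklore] -/
theorem lu_item_10 : (luRec.lookup 100).kind = .interval ∧ (luRec.lookup 100).word = none := by
  decide

/-- At 50 GPa (inside (22, 88)): an interval item with no word. [folklore] -/
theorem lu_item_50 : (luRec.lookup 500).kind = .interval ∧ (luRec.lookup 500).word = none := by
  decide

/-- At 100 GPa (inside (88, 174)): an interval item carrying EPH («interpolated»). [folklore] -/
theorem lu_item_100 : (luRec.lookup 1000).kind = .interval ∧ (luRec.lookup 1000).word = some EPH := by
  decide

/-- At 200 GPa (beyond the last column, no admissible reach): unrouted, no word. [folklore] -/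
theorem lu_item_200 : (luRec.lookup 2000).kind = .unrouted ∧ (luRec.lookup 2000).word = none := by
  decide

/-- At 0.5 GPa (the identity span below the first column): a reach item carrying EPH. [folklore] -/
theorem lu_item_0p5 : (luRec.lookup 5).kind = .reach ∧ (luRec.lookup 5).word = some EPH := by
  decide

/-- The classes: «screening» exactly at the four columns (instances of `conf_eq_screening_iff`).
[folklore] -/
theorem lu_conf_columns :
    (luRec.lookup 8).conf = .screening ∧ (luRec.lookup 220).conf = .screening ∧
      (luRec.lookup 880).conf = .screening ∧ (luRec.lookup 1740).conf = .screening := by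
  decide

/-- Strictly inside (88, 174) the class is «interpolated», inside (0.8, 22) it is «none», below 0.8 it
is «extrapolated» (the identity reach prints as a reach item). [folklore] -/
theorem lu_conf_inside :
    (luRec.lookup 1000).conf = .interpolated ∧ (luRec.lookup 100).conf = .none ∧
      (luRec.lookup 5).conf = .extrapolated := by
  decide

/-- 88 and 174 GPa are CONSECUTIVE computed columns. [folklore] -/
theorem lu_consecutive_88_174 : luRec.Consecutive 880 1740 := by
  unfold Rec.Consecutive; decide

/-- 0.8 and 22 GPa are consecutive computed columns. [folklore] -/
theorem lu_consecutive_0p8_22 : luRec.Consecutive 8 220 := by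
  unfold Rec.Consecutive; decide

/-- **The gap (88, 174) is DECIDED with word EPH** (interval word = both end words). [folklore] -/
theorem lu_decided_88_174 : luRec.Decided 880 1740 EPH := by
  unfold Rec.Decided Rec.Consecutive; decide

/-- No reach lies inside (88, 174). [folklore] -/
theorem lu_no_reach_88_174 : ∀ P, 880 < P → P < 1740 → luRec.rw P = none := by
  intro P hP _
  have h8 : ¬P < 8 := by omega
  simp [luRec, h8]

/-- **Every pressure of the CLOSED gap [88, 174] GPa carries the word EPH** — the general theorem
`Rec.word_eq_on_gap_of_decided` applied to the typed record (words extend across a decided gap).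
[folklore] -/
theorem lu_word_on_88_174 {P : ℕ} (h₁ : 880 ≤ P) (h₂ : P ≤ 1740) :
    (luRec.lookup P).word = some EPH :=
  Rec.word_eq_on_gap_of_decided lu_decided_88_174 lu_no_reach_88_174 h₁ h₂

/-- **… while strictly inside the class is «interpolated», never «screening»** (the confidence does
not extend; `Rec.conf_lookup_of_mem_gap`). [folklore] -/
theorem lu_conf_inside_88_174 {P : ℕ} (h₁ : 880 < P) (h₂ : P < 1740) :
    (luRec.lookup P).conf = .interpolated :=
  Rec.conf_lookup_of_mem_gap lu_decided_88_174 lu_no_reach_88_174 h₁ h₂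

/-- **No word strictly inside the undetermined gap (0.8, 22)** (`Rec.word_lookup_of_undetermined`).
[folklore] -/
theorem lu_no_word_inside_0p8_22 {P : ℕ} (h₁ : 8 < P) (h₂ : P < 220) :
    (luRec.lookup P).word = none ∧ (luRec.lookup P).conf = .none := by
  have hgw : luRec.gw 8 = none := by decide
  have hrw : luRec.rw P = none := by
    have h8 : ¬P < 8 := by omega
    simp [luRec, h8]
  exact Rec.word_lookup_of_undetermined lu_consecutive_0p8_22 hgw hrw h₁ h₂

end PCont

end Summit.Ventures.CertifiedManyBodySolver.Downfold
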